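import Mathlib
import Summits.Ventures.PercRepro2.OneTypedEdge

/-!
# The coincidence `o = a₃` kills every typed base (blind cell PercRepro2, night-3 g3, 2026-08-24)

With `o = a₃` one has `σ_o = σ₃` and `1_{o∈U} = 1_{a₃∈U}`, so `f₃ = 1_PD·1_{a₃∈U} = 0`, `f₁₁ = 0`,
`f₄ = f₆`, `f₈ = f₁₀`, and the eight terms of `K₃` cancel in pairs: `K₃ ≡ 0` pointwise
(`K3_eq_zero_of_o_eq_a3`, through `K3_eq_KB` and a `decide +kernel` over the 2¹⁵ state triples with
`Lo = L3`, `Ho = H3`), hence every typed base vanishes (`typedCount_eq_zero_of_o_eq_a3`). This is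
the third root-type coincidence of the typed vanishing table (`TypedVanishing.lean`: `o ∈ {a₁, a₂}`,
`b ∈ {a₁, a₂}`, `a₃ ∈ {a₁, a₂}`); the coincidences `b = a₃` and `o = b` do NOT vanish (exact check on
the abstract instances, `NIGHT3-CERT.md` §12.8). Own code; standard axioms.
-/

namespace Summit.Ventures.PercRepro2

open UnionCluster

namespace CovForm

namespace TypedA3

section Coincidence

open OneTyped

/-- `KB` vanishes on state triples in which `o` and `a₃` carry the same side data in every copy
(with `σ_o = σ₃`, `u_o = u₃`: `f₃ = 1_PD 1_{a₃∈U} = 0`, `f₁₁ = 0`, `f₄ = f₆ = f₅`, `f₈ = f₁₀ = f₉`, and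
the eight terms cancel in pairs). -/
theorem KB_eq_zero_of_o_eq_a3 (x y z : St) (hx : x.Lo = x.L3 ∧ x.Ho = x.H3)
    (hy : y.Lo = y.L3 ∧ y.Ho = y.H3) (hz : z.Lo = z.L3 ∧ z.Ho = z.H3) : KB x y z = 0 := by
  obtain ⟨q1, lo1, ho1, lb1, hb1, l31, h31⟩ := x
  obtain ⟨q2, lo2, ho2, lb2, hb2, l32, h32⟩ := y
  obtain ⟨q3, lo3, ho3, lb3, hb3, l33, h33⟩ := z
  simp only [St.Lo, St.Ho, St.L3, St.H3] at hx hy hz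
  obtain ⟨rfl, rfl⟩ := hx
  obtain ⟨rfl, rfl⟩ := hy
  obtain ⟨rfl, rfl⟩ := hz
  revert q1 lo1 ho1 lb1 hb1 q2 lo2 ho2 lb2 hb2 q3 lo3 ho3 lb3 hb3
  decide +kernel

variable {V : Type*} {E : Type*} [Fintype E] [DecidableEq E] {R : Type*} [Field R]

omit [Fintype E] [DecidableEq E] in
/-- **`K₃ ≡ 0` when `o = a₃`** (pointwise, every configuration triple). -/
theorem K3_eq_zero_of_o_eq_a3 (ends : E → Sym2 V) (a₁ a₂ a₃ b : V) (x y w : Config E) :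
    (K3 ends a₃ a₁ a₂ a₃ b x y w : R) = 0 := by
  rw [K3_eq_KB ends a₃ a₁ a₂ a₃ b x y w]
  have h : ∀ ω : Config E, (st ends a₃ a₁ a₂ a₃ b ω).Lo = (st ends a₃ a₁ a₂ a₃ b ω).L3 ∧
      (st ends a₃ a₁ a₂ a₃ b ω).Ho = (st ends a₃ a₁ a₂ a₃ b ω).H3 := fun ω => ⟨rfl, rfl⟩
  rw [KB_eq_zero_of_o_eq_a3 _ _ _ (h x) (h y) (h w)]
  simp

/-- **Every typed base vanishes when `o = a₃`** — the third root-type coincidence of the typed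
vanishing table (`TypedVanishing.lean` has `o = a₁`, `o = a₂`, `b = a₁`, `b = a₂`, `a₃ = a₁`,
`a₃ = a₂`; `b = a₃` and `o = b` are the live coincidences). -/
theorem typedCount_eq_zero_of_o_eq_a3 (ends : E → Sym2 V) (a₁ a₂ a₃ b : V) (F : Finset E)
    (z : Config E) (τ : E → ℕ) :
    typedCount F z τ (K3 ends a₃ a₁ a₂ a₃ b : Config E → Config E → Config E → R) = 0 := by
  unfold typedCount
  refine Finset.sum_eq_zero fun x _ => Finset.sum_eq_zero fun y _ => Finset.sum_eq_zero fun w _ => ?_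
  rw [K3_eq_zero_of_o_eq_a3]
  simp

end Coincidence

end TypedA3

end CovForm

end Summit.Ventures.PercRepro2
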